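import Mathlib.Analysis.InnerProductSpace.Orientation
import Mathlib.Analysis.InnerProductSpace.TwoDim
import Mathlib.Analysis.InnerProductSpace.PiL2
import Mathlib.Analysis.Normed.Module.Alternating.Basic
import Mathlib.Topology.Algebra.Module.Alternating.Topology
import Mathlib.Order.Hom.PowersetCard
import Mathlib.LinearAlgebra.BilinearForm.Properties
import Summits.Ventures.HodgeRepro2.HostAPI.Carriers.Geometry.Kaehler.AlternatingAux
import Summits.Ventures.HodgeRepro2.HostAPI.Util.ForallBinderLint
open HostAPI.Carriers

noncomputable section

open Module ContinuousAlternatingMap HostAPI.Carriers.ContinuousAlternatingMap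

namespace HostAPI.Carriers.Geometry.Kaehler

variable {V : Type*} [NormedAddCommGroup V] [InnerProductSpace ℝ V]

section VolumeForm

variable {n : ℕ} [Fact (finrank ℝ V = n)] (o : Orientation ℝ V (Fin n))

def _root_.HostAPI.Carriers.Orientation.volumeFormL : V [⋀^Fin n]→L[ℝ] ℝ :=
  o.volumeForm.mkContinuous 1 (fun v ↦ by simpa using o.abs_volumeForm_apply_le v)

@[simp]
theorem _root_.HostAPI.Carriers.Orientation.volumeFormL_apply (v : Fin n → V) :
    o.volumeFormL v = o.volumeForm v :=
  rfl

@[simp]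
theorem _root_.HostAPI.Carriers.Orientation.toAlternatingMap_volumeFormL :
    o.volumeFormL.toAlternatingMap = o.volumeForm :=
  rfl

@[simp]
theorem _root_.HostAPI.Carriers.Orientation.volumeFormL_neg : (-o).volumeFormL = -o.volumeFormL := by
  ext v
  simp [Orientation.volumeForm_neg_orientation]

end VolumeForm

section Basis

variable {n : ℕ}

variable (V n) in

def stdOrthonormalBasisFin [FiniteDimensional ℝ V] [Fact (finrank ℝ V = n)] :
    OrthonormalBasis (Fin n) ℝ V :=
  (stdOrthonormalBasis ℝ V).reindex (finCongr Fact.out)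

def _root_.HostAPI.Carriers.OrthonormalBasis.multiIndex (b : OrthonormalBasis (Fin n) ℝ V) {k : ℕ}
    (s : Set.powersetCard (Fin n) k) : Fin k → V :=
  fun i ↦ b (Set.powersetCard.ofFinEmbEquiv.symm s i)

@[simp]
theorem _root_.HostAPI.Carriers.OrthonormalBasis.multiIndex_apply (b : OrthonormalBasis (Fin n) ℝ V) {k : ℕ}
    (s : Set.powersetCard (Fin n) k) (i : Fin k) :
    b.multiIndex s i = b (Set.powersetCard.ofFinEmbEquiv.symm s i) :=
  rfl

end Basis

section Inner

variable [FiniteDimensional ℝ V] (V) (n : ℕ) [Fact (finrank ℝ V = n)]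

def alternatingFormInner (k : ℕ) : LinearMap.BilinForm ℝ (V [⋀^Fin k]→L[ℝ] ℝ) :=
  ∑ s : Set.powersetCard (Fin n) k,
    (ContinuousAlternatingMap.apply ℝ V ℝ
      ((stdOrthonormalBasisFin V n).multiIndex s)).toLinearMap.smulRight
      (ContinuousAlternatingMap.apply ℝ V ℝ ((stdOrthonormalBasisFin V n).multiIndex s)).toLinearMap

variable {V n}

@[simp]
theorem alternatingFormInner_apply (k : ℕ) (α β : V [⋀^Fin k]→L[ℝ] ℝ) :
    alternatingFormInner V n k α β = ∑ s : Set.powersetCard (Fin n) k,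
      α ((stdOrthonormalBasisFin V n).multiIndex s) *
        β ((stdOrthonormalBasisFin V n).multiIndex s) := by
  simp [alternatingFormInner, LinearMap.sum_apply]

def alternatingFormInner_eq_sum : Prop :=
  ∀ (b : OrthonormalBasis (Fin n) ℝ V) (k : ℕ) (α β : V [⋀^Fin k]→L[ℝ] ℝ),
    alternatingFormInner V n k α β =
      ∑ s : Set.powersetCard (Fin n) k, α (b.multiIndex s) * β (b.multiIndex s)

theorem isSymm_alternatingFormInner (k : ℕ) : (alternatingFormInner V n k).IsSymm :=
  LinearMap.BilinForm.isSymm_def.2 fun α β ↦ by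
    simp only [alternatingFormInner_apply, mul_comm (α _)]

theorem alternatingFormInner_self_nonneg (k : ℕ) (α : V [⋀^Fin k]→L[ℝ] ℝ) :
    0 ≤ alternatingFormInner V n k α α := by
  rw [alternatingFormInner_apply]
  exact Finset.sum_nonneg fun s _ ↦ mul_self_nonneg _

def alternatingFormInner_self_eq_zero_iff : Prop :=
  ∀ (k : ℕ) (α : V [⋀^Fin k]→L[ℝ] ℝ),
    alternatingFormInner V n k α α = 0 ↔ α = 0

def alternatingFormInner_volumeFormL_volumeFormL : Prop :=
  ∀ (o : Orientation ℝ V (Fin n)),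
    alternatingFormInner V n n o.volumeFormL o.volumeFormL = 1

end Inner

section HodgeStar

variable [FiniteDimensional ℝ V] {n : ℕ} [Fact (finrank ℝ V = n)] (o : Orientation ℝ V (Fin n))
  {k m : ℕ}

def hodgeStar (h : k + m = n) : (V [⋀^Fin k]→L[ℝ] ℝ) →ₗ[ℝ] (V [⋀^Fin m]→L[ℝ] ℝ) :=
  ∑ s : Set.powersetCard (Fin n) k,
    (ContinuousAlternatingMap.apply ℝ V ℝ
      ((stdOrthonormalBasisFin V n).multiIndex s)).toLinearMap.smulRight
      ((o.volumeFormL.domDomCongr (finCongr (show n = m + k by omega))).interiorProductMulti k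
        ((stdOrthonormalBasisFin V n).multiIndex s))

@[simp]
theorem hodgeStar_apply (h : k + m = n) (β : V [⋀^Fin k]→L[ℝ] ℝ) (w : Fin m → V) :
    hodgeStar o h β w = ∑ s : Set.powersetCard (Fin n) k,
      β ((stdOrthonormalBasisFin V n).multiIndex s) *
        (o.volumeFormL.domDomCongr (finCongr (show n = m + k by omega))).interiorProductMulti k
          ((stdOrthonormalBasisFin V n).multiIndex s) w := by
  simp [hodgeStar, LinearMap.sum_apply]

def hodgeStar_apply_eq_sum : Prop :=
  ∀ (b : OrthonormalBasis (Fin n) ℝ V) (h : k + m = n) (β : V [⋀^Fin k]→L[ℝ] ℝ) (w : Fin m → V),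
    hodgeStar o h β w = ∑ s : Set.powersetCard (Fin n) k,
      β (b.multiIndex s) *
        (o.volumeFormL.domDomCongr (finCongr (show n = m + k by omega))).interiorProductMulti k
          (b.multiIndex s) w

def hodgeStar_hodgeStar : Prop :=
  ∀ (h : k + m = n) (h' : m + k = n) (β : V [⋀^Fin k]→L[ℝ] ℝ),
    hodgeStar o h' (hodgeStar o h β) = ((-1 : ℝ) ^ (k * m)) • β

def alternatingFormInner_hodgeStar_hodgeStar : Prop :=
  ∀ (h : k + m = n) (α β : V [⋀^Fin k]→L[ℝ] ℝ),
    alternatingFormInner V n m (hodgeStar o h α) (hodgeStar o h β) =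
      alternatingFormInner V n k α β

theorem hodgeStar_neg_orientation (h : k + m = n) : hodgeStar (-o) h = -hodgeStar o h := by
  ext β w
  rw [LinearMap.neg_apply, ContinuousAlternatingMap.neg_apply, hodgeStar_apply, hodgeStar_apply,
    Orientation.volumeFormL_neg, ← neg_one_smul ℝ o.volumeFormL, domDomCongr_smul,
    ← Finset.sum_neg_distrib]
  refine Finset.sum_congr rfl fun s _ ↦ ?_
  rw [interiorProductMulti_smul, ContinuousAlternatingMap.smul_apply, smul_eq_mul]
  ring

def hodgeStar_constOfIsEmpty_one : Prop :=
  ∀ (h : 0 + n = n),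
    hodgeStar o h (constOfIsEmpty ℝ V (Fin 0) 1) = o.volumeFormL

def hodgeStar_volumeFormL : Prop :=
  ∀ (h : n + 0 = n),
    hodgeStar o h o.volumeFormL = constOfIsEmpty ℝ V (Fin 0) 1

def hodgeStar_apply_eq_alternatingFormInner : Prop :=
  ∀ (h : k + m = n) (β : V [⋀^Fin k]→L[ℝ] ℝ) (w : Fin m → V),
    hodgeStar o h β w = (-1 : ℝ) ^ (k * m) * alternatingFormInner V n k β
      ((o.volumeFormL.domDomCongr (finCongr (show n = k + m by omega))).interiorProductMulti m w)

def hodgeStar_injective : Prop :=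
  ∀ (h : k + m = n),
    Function.Injective (hodgeStar o h)

end HodgeStar

section TwoDim

variable [FiniteDimensional ℝ V] [Fact (finrank ℝ V = 2)] (o : Orientation ℝ V (Fin 2))

def hodgeStar_apply_eq_areaForm : Prop :=
  ∀ (h : 1 + 1 = 2) (v w : V),
    hodgeStar o h (ofSubsingleton ℝ V ℝ (0 : Fin 1) (innerSL ℝ v)) ![w] = o.areaForm v w

end TwoDim

end HostAPI.Carriers.Geometry.Kaehler
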